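import Summits.AtomisticToContinuum.FouriersLaw.Theorems.CageBudgetFeketeHeatVarianceCalculus
import Summits.AtomisticToContinuum.FouriersLaw.Theorems.ParityLiouvilleSeedLiouvilleForHeatOrbitMeasure
import Summits.AtomisticToContinuum.FouriersLaw.Theorems.ParityLiouvilleSeedCesaroUpgradeGrowth
import Literature.MathematicalPhysics.KineticTheory.InfiniteChainObservables
import Literature.MathematicalPhysics.KineticTheory.InfiniteChainGibbsStationarityPinned
import Literature.MathematicalPhysics.KineticTheory.InfiniteChainCovarianceMixingBox
import Literature.MathematicalPhysics.KineticTheory.InfiniteChainCurrentPositiveType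
import HarnessLib

/-!
# Stub S2 `stub_coboundaryInequality` of line `dual-certificate`, crux `CageBudgetFekete.HeatVarianceCeiling`
(item stmt-AtomisticToContinuum-15770; `--supports` file, closes nothing)

**The approximate-potential / coboundary inequality at finite block size** (EXACT at every `n`, no
clustering, no decay): in the arena of the crux (pinned chain, shift-invariant DLR state `μ` at
`T > 0`, `μ`-preserving dynamics `D`), for every bounded `C¹` local `u`, `τ ≥ 0`, `n`:
`∫ (∫_{(0,τ]} J_n(φ_s σ) ds)² dμ ≤ (2 √Var(A_n u) + τ √Var(A_n r))²`, `r = j₀ − 𝒜u`,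
`A_n f = Σ_{i<n} f∘τ_i` (`τ_i = chainShift i`), `J_n = Σ_{i<n} j_i`.

Proof. ORBITS: `s ↦ τ_i(φ_s σ)` solves the equations of motion (`IsSolution.chainShift`), so the
FTC along solutions (`ParityLiouvilleSeed.intervalIntegral_liouvilleZ_comp_of_isSolution`) and
`j_i = j₀∘τ_i` give, on the carrier, `∫_{(0,τ]} J_n∘φ_s = (A u)∘φ_τ − A u + ∫_{(0,τ]} (A r)∘φ_s`
(`cob_pointwise`). `L²`: Minkowski (`sqrt_integral_add_sq_le`); `‖(A u)∘φ_τ − A u‖₂ ≤ 2 sd(A u)`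
(common mean, measure preservation: `cob_sqrt_integral_comp_sub_sq_le`);
`‖∫_{(0,τ]} (A r)∘φ_s‖₂² ≤ τ² ∫(A r)²` by Fubini on the time square for the jointly measurable
modification on a measurable co-null part of the carrier and the Koopman bound — the device of the
tree's `InfiniteChainDynamics.integral_Ioc_sub_mul_nonneg` (`cob_setIntegral_indicator_flow`);
`∫ A r = 0` (`∫ j₀ = 0`, `∫ 𝒜u = 0`: `isTimeInvariant_pinnedChain_of_isShiftInvariant`), so
`∫ (A r)² = Var(A r)`. MOMENTS: `j₀ ∈ L²` (superstability), `𝒜u ∈ L²` (cubic growth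
`CesaroUpgrade.exists_abs_liouvilleZ_le_growth` + site moments of order 6), `A u` bounded.
Everything used is in the tree; no named fact. [folklore] [cite: DeRoeckHuveneers2015, §2.3 Thm 1]
-/

noncomputable section

namespace Summit.AtomisticToContinuum.FouriersLaw.Theorems.HeatVarianceCeiling.DualCertificate

open MeasureTheory ProbabilityTheory Filter Set Function
open Literature.MathematicalPhysics.KineticTheory.HeatConduction

/-- **Centring by the common mean**: for `f ∈ L²(μ)` (probability measure) and a `μ`-preserving
`φ`, `f∘φ − f ∈ L²(μ)` and `‖f∘φ − f‖₂ ≤ 2 sd(f)` (`f∘φ − f = (f∘φ − m) + (m − f)`, `m = ∫ f`,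
Minkowski, `∫ (f∘φ − m)² = ∫ (f − m)² = Var f`). [folklore] -/
theorem cob_sqrt_integral_comp_sub_sq_le {Ω : Type*} [MeasurableSpace Ω] {μ : Measure Ω}
    [IsProbabilityMeasure μ] {φ : Ω → Ω} (hφ : MeasurePreserving φ μ μ) {f : Ω → ℝ}
    (hf : Measurable f) (hf2 : MemLp f 2 μ) :
    MemLp (fun ω => f (φ ω) - f ω) 2 μ ∧
      Real.sqrt (∫ ω, (f (φ ω) - f ω) ^ 2 ∂μ) ≤ 2 * Real.sqrt (variance f μ) := by
  set m : ℝ := ∫ ω, f ω ∂μ with hm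
  have h1 : MemLp (fun ω => f (φ ω) - m) 2 μ :=
    (hf2.comp_measurePreserving hφ).sub (memLp_const m)
  have h2 : MemLp (fun ω => m - f ω) 2 μ := (memLp_const m).sub hf2
  have hvar : variance f μ = ∫ ω, (f ω - m) ^ 2 ∂μ := variance_eq_integral hf.aemeasurable
  have hI1 : ∫ ω, (f (φ ω) - m) ^ 2 ∂μ = variance f μ := by
    rw [hvar]
    exact integral_comp_eq_of_measurePreserving hφ (g := fun ω => (f ω - m) ^ 2)
      ((hf.sub_const m).pow_const 2)
  have hI2 : ∫ ω, (m - f ω) ^ 2 ∂μ = variance f μ := by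
    rw [hvar]
    exact integral_congr_ae (Eventually.of_forall fun ω => by ring)
  have heq : (fun ω => f (φ ω) - f ω) = fun ω => (f (φ ω) - m) + (m - f ω) := by
    funext ω
    ring
  refine ⟨by rw [heq]; exact h1.add h2, ?_⟩
  calc Real.sqrt (∫ ω, (f (φ ω) - f ω) ^ 2 ∂μ)
      = Real.sqrt (∫ ω, ((f (φ ω) - m) + (m - f ω)) ^ 2 ∂μ) := by
        congr 1
        exact integral_congr_ae (Eventually.of_forall fun ω => by ring)
    _ ≤ Real.sqrt (∫ ω, (f (φ ω) - m) ^ 2 ∂μ) + Real.sqrt (∫ ω, (m - f ω) ^ 2 ∂μ) :=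
        sqrt_integral_add_sq_le h1 h2
    _ = 2 * Real.sqrt (variance f μ) := by rw [hI1, hI2]; ring

section Koopman

variable {P : OscillatorChain} (D : InfiniteChainDynamics P) {μ : Measure ChainConfig}

/-- **`‖∫_{(0,t]} g∘φ_u du‖₂ ≤ t ‖g‖₂` along a measure-preserving dynamics.** For `g ∈ L²(μ)`
measurable and continuous along the orbits of the carrier, and a measurable full-measure part `S`
of the carrier: the jointly measurable modification `K(u, σ) = 1_S(σ) g(φ_u σ)` has
`σ ↦ ∫_{(0,t]} K(u, σ) du ∈ L²(μ)` with `∫ (∫_{(0,t]} K(u,σ) du)² dμ ≤ t² ∫ g² dμ` (Fubini on the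
time square and the Koopman bound `∫ |g∘φ_s · g∘φ_u| dμ ≤ ∫ g² dμ`; the device of the tree's
`InfiniteChainDynamics.integral_Ioc_sub_mul_nonneg`). [folklore] -/
theorem cob_setIntegral_indicator_flow [IsFiniteMeasure μ] (hD : D.PreservesMeasure μ)
    {S : Set ChainConfig} (hSm : MeasurableSet S) (hSsub : S ⊆ D.carrier)
    (hSae : ∀ᵐ σ ∂μ, σ ∈ S) {g : ChainConfig → ℝ} (hg : Measurable g) (hg2 : MemLp g 2 μ)
    (hcont : ∀ σ ∈ D.carrier, Continuous fun t => g (D.flow t σ)) {t : ℝ} (ht : 0 ≤ t) :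
    MemLp (fun σ => ∫ u in Ioc (0:ℝ) t, S.indicator (fun σ => g (D.flow u σ)) σ) 2 μ ∧
      ∫ σ, (∫ u in Ioc (0:ℝ) t, S.indicator (fun σ => g (D.flow u σ)) σ) ^ 2 ∂μ ≤
        t ^ 2 * ∫ σ, g σ ^ 2 ∂μ := by
  -- the jointly measurable modification of `(u, σ) ↦ g (φ_u σ)`
  set K : ℝ → ChainConfig → ℝ := fun u σ => S.indicator (fun σ => g (D.flow u σ)) σ with hKdef
  have hKm : ∀ u, Measurable (K u) := fun u => (hg.comp (hD.2 u).measurable).indicator hSm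
  have hKc : ∀ σ, Continuous fun u => K u σ := by
    intro σ
    by_cases hσ : σ ∈ S
    · simp only [hKdef, indicator_of_mem hσ]
      exact hcont σ (hSsub hσ)
    · simp only [hKdef, indicator_of_notMem hσ]
      exact continuous_const
  have hKjm : Measurable (Function.uncurry K) :=
    measurable_uncurry_of_continuous_of_measurable hKc hKm
  have hKae : ∀ u, K u =ᵐ[μ] fun σ => g (D.flow u σ) := fun u => by
    filter_upwards [hSae] with σ hσ
    simp only [hKdef, indicator_of_mem hσ]
  have hK2 : ∀ u, MemLp (K u) 2 μ := fun u =>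
    (hg2.comp_measurePreserving (hD.2 u)).ae_eq (hKae u).symm
  set A : ℝ := ∫ σ, g σ ^ 2 ∂μ with hAdef
  have hKKabs : ∀ s u, ∫ σ, |K s σ * K u σ| ∂μ ≤ A := by
    intro s u
    have hae : (fun σ => |K s σ * K u σ|) =ᵐ[μ] fun σ => |g (D.flow s σ) * g (D.flow u σ)| := by
      filter_upwards [hSae] with σ hσ
      simp only [hKdef, indicator_of_mem hσ]
    rw [integral_congr_ae hae]
    exact D.integral_abs_comp_flow_mul_comp_flow_le hD hg hg2 s u
  have hKKle : ∀ s u, ∫ σ, K s σ * K u σ ∂μ ≤ A := fun s u =>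
    (le_abs_self _).trans (abs_integral_le_integral_abs.trans (hKKabs s u))
  -- the product measure on the time square
  set ρ : Measure ℝ := volume.restrict (Ioc (0:ℝ) t) with hρdef
  set π : Measure (ℝ × ℝ) := ρ.prod ρ with hπdef
  have hHm : Measurable fun x : (ℝ × ℝ) × ChainConfig => K x.1.1 x.2 * K x.1.2 x.2 :=
    (hKjm.comp (measurable_fst.fst.prodMk measurable_snd)).mul
      (hKjm.comp (measurable_fst.snd.prodMk measurable_snd))
  have hHint : Integrable (fun x : (ℝ × ℝ) × ChainConfig => K x.1.1 x.2 * K x.1.2 x.2)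
      (π.prod μ) := by
    refine (integrable_prod_iff hHm.aestronglyMeasurable).2 ⟨Eventually.of_forall fun p => ?_, ?_⟩
    · exact (hK2 p.1).integrable_mul (hK2 p.2)
    · refine Integrable.mono' (integrable_const A) hHm.aestronglyMeasurable.norm.integral_prod_right'
        (Eventually.of_forall fun p => ?_)
      show ‖∫ σ, ‖K p.1 σ * K p.2 σ‖ ∂μ‖ ≤ A
      rw [Real.norm_eq_abs, abs_of_nonneg (integral_nonneg fun σ => norm_nonneg _)]
      simp only [Real.norm_eq_abs]
      exact hKKabs p.1 p.2
  have hsq : ∀ σ, (∫ u, K u σ ∂ρ) ^ 2 = ∫ p, K p.1 σ * K p.2 σ ∂π := fun σ => by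
    rw [sq, hπdef, ← integral_prod_mul (μ := ρ) (ν := ρ) (fun u => K u σ) (fun u => K u σ)]
  have hHint' : Integrable (Function.uncurry fun (σ : ChainConfig) (p : ℝ × ℝ) => K p.1 σ * K p.2 σ)
      (μ.prod π) := hHint.swap
  -- `Y σ = ∫ K(u, σ) du` is measurable with `Y² ∈ L¹(μ)`
  have hYm : StronglyMeasurable fun σ => ∫ u, K u σ ∂ρ :=
    StronglyMeasurable.integral_prod_left (μ := ρ) hKjm.stronglyMeasurable
  have hY2int : Integrable (fun σ => (∫ u, K u σ ∂ρ) ^ 2) μ := by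
    refine hHint'.integral_prod_left.congr (Eventually.of_forall fun σ => ?_)
    simp only [Function.uncurry_apply_pair]
    exact (hsq σ).symm
  have hπreal : π.real univ = t ^ 2 := by
    rw [hπdef, ← univ_prod_univ, measureReal_prod_prod, hρdef, measureReal_restrict_apply_univ,
      Real.volume_real_Ioc_of_le ht, sub_zero, sq]
  refine ⟨(memLp_two_iff_integrable_sq hYm.aestronglyMeasurable).2 hY2int, ?_⟩
  calc ∫ σ, (∫ u, K u σ ∂ρ) ^ 2 ∂μ = ∫ σ, ∫ p, K p.1 σ * K p.2 σ ∂π ∂μ := by simp only [hsq]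
    _ = ∫ p, ∫ σ, K p.1 σ * K p.2 σ ∂μ ∂π := integral_integral_swap hHint'
    _ ≤ ∫ _p, A ∂π :=
        integral_mono hHint.integral_prod_left (integrable_const A) fun p => hKKle p.1 p.2
    _ = t ^ 2 * A := by rw [integral_const, smul_eq_mul, hπreal]

end Koopman

/-- For a local test function `u`, a chain with `C²` potentials and a solution `γ` of the
equations of motion: `s ↦ (𝒜u)(γ s)` is continuous and `∫₀ᵗ (𝒜u)(γ s) ds = u(γ t) − u(γ 0)`
(chain rule along solutions for `u = g ∘ box`). [folklore] -/
theorem cob_orbit {P : OscillatorChain} (hU : ContDiff ℝ 2 P.U) (hV : ContDiff ℝ 2 P.V)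
    {u : ChainConfig → ℝ} (hu : IsLocalTestFunction u) {γ : ℝ → ChainConfig}
    (hγ : P.IsSolution γ) :
    (Continuous fun s => liouvilleZ P u (γ s)) ∧
      ∀ t : ℝ, ∫ s in (0:ℝ)..t, liouvilleZ P u (γ s) = u (γ t) - u (γ 0) := by
  obtain ⟨R, g, hg, -, -, rfl⟩ := hu
  rw [boxRestrict_eq_boxRestrictAt]
  exact ⟨ParityLiouvilleSeed.continuous_liouvilleZ_comp_of_isSolution hU hV hγ _ _ hg,
    fun t => ParityLiouvilleSeed.intervalIntegral_liouvilleZ_comp_of_isSolution hU hV hγ _ _ hg t⟩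

/-- **The pointwise coboundary identity on the carrier.** For `σ` in the carrier of `D`,
`τ ≥ 0`, a local test function `u` and `r = j₀ − 𝒜u`:
`∫_{(0,τ]} J_n(φ_s σ) ds = (A_n u)(φ_τ σ) − (A_n u)(σ) + ∫_{(0,τ]} (A_n r)(φ_s σ) ds`
(`j_i = j₀ ∘ τ_i`, the translated orbits `s ↦ τ_i(φ_s σ)` are solutions, FTC along them).
[folklore] -/
theorem cob_pointwise {P : OscillatorChain} (hU : ContDiff ℝ 2 P.U) (hV : ContDiff ℝ 2 P.V)
    (D : InfiniteChainDynamics P) {u : ChainConfig → ℝ} (hu : IsLocalTestFunction u)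
    {σ : ChainConfig} (hσ : σ ∈ D.carrier) {τ : ℝ} (hτ : 0 ≤ τ) (n : ℕ) :
    ∫ s in Ioc (0:ℝ) τ, ∑ i ∈ Finset.range n, P.bondCurrentZ (D.flow s σ) (i : ℤ) =
      (∑ i ∈ Finset.range n, u (chainShift (i : ℤ) (D.flow τ σ))) -
          (∑ i ∈ Finset.range n, u (chainShift (i : ℤ) σ)) +
        ∫ s in Ioc (0:ℝ) τ, ∑ i ∈ Finset.range n,
          (P.bondCurrentZ (chainShift (i : ℤ) (D.flow s σ)) 0 -
            liouvilleZ P u (chainShift (i : ℤ) (D.flow s σ))) := by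
  have hVc : Continuous (deriv P.V) := hV.continuous_deriv (by norm_num)
  -- the translated orbits are solutions: continuity and FTC along them
  have hsol : ∀ i : ℕ, P.IsSolution fun s => chainShift (i : ℤ) (D.flow s σ) := fun i =>
    (D.isSolution σ hσ).chainShift (i : ℤ)
  have hLc : ∀ i : ℕ, Continuous fun s => liouvilleZ P u (chainShift (i : ℤ) (D.flow s σ)) :=
    fun i => (cob_orbit hU hV hu (hsol i)).1
  have hftc : ∀ i : ℕ, ∫ s in (0:ℝ)..τ, liouvilleZ P u (chainShift (i : ℤ) (D.flow s σ)) =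
      u (chainShift (i : ℤ) (D.flow τ σ)) - u (chainShift (i : ℤ) σ) := fun i => by
    simpa only [D.flow_zero σ hσ] using (cob_orbit hU hV hu (hsol i)).2 τ
  have hjc : ∀ i : ℕ, Continuous fun s => P.bondCurrentZ (chainShift (i : ℤ) (D.flow s σ)) 0 :=
    fun i => by
    simp only [P.bondCurrentZ_chainShift, zero_add]
    exact D.continuous_bondCurrentZ_flow hVc hσ i
  -- the algebraic identity `J_n = Σ_i (𝒜u)∘τ_i + A_n r`
  have halg : ∀ s, ∑ i ∈ Finset.range n, P.bondCurrentZ (D.flow s σ) (i : ℤ) =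
      (∑ i ∈ Finset.range n, liouvilleZ P u (chainShift (i : ℤ) (D.flow s σ))) +
        ∑ i ∈ Finset.range n, (P.bondCurrentZ (chainShift (i : ℤ) (D.flow s σ)) 0 -
          liouvilleZ P u (chainShift (i : ℤ) (D.flow s σ))) := fun s => by
    rw [← Finset.sum_add_distrib]
    refine Finset.sum_congr rfl fun i _ => ?_
    rw [P.bondCurrentZ_chainShift, zero_add]
    ring
  have hI1 : ∀ i ∈ Finset.range n, IntegrableOn
      (fun s => liouvilleZ P u (chainShift (i : ℤ) (D.flow s σ))) (Ioc (0:ℝ) τ) :=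
    fun i _ => (hLc i).integrableOn_Ioc
  have hI2 : IntegrableOn (fun s => ∑ i ∈ Finset.range n,
      (P.bondCurrentZ (chainShift (i : ℤ) (D.flow s σ)) 0 -
        liouvilleZ P u (chainShift (i : ℤ) (D.flow s σ)))) (Ioc (0:ℝ) τ) :=
    (continuous_finsetSum _ fun i _ => (hjc i).sub (hLc i)).integrableOn_Ioc
  simp only [halg]
  rw [integral_add (integrable_finsetSum _ hI1) hI2, integral_finsetSum _ hI1,
    ← Finset.sum_sub_distrib]
  congr 1
  refine Finset.sum_congr rfl fun i _ => ?_
  rw [← intervalIntegral.integral_of_le hτ, hftc i]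

/-- For the pinned chain (`ω₂, lam, β > 0`), a shift-invariant DLR state `μ` at `T > 0` and a
local test function `u`: `𝒜u ∈ L²(μ)` (cubic growth of `𝒜u` in a box and the site moments of
order `6` of the superstable shift-invariant state). [folklore] -/
theorem cob_memLp_liouvilleZ {ω₂ lam β : ℝ} (γ : ℝ) (hω : 0 < ω₂) (hl : 0 < lam) (hβ : 0 < β)
    {T : ℝ} (hT : 0 < T) {μ : Measure ChainConfig}
    (hG : (pinnedChain ω₂ lam β γ).IsChainGibbsMeasure T μ) (hSI : IsShiftInvariant μ)
    {u : ChainConfig → ℝ} (hu : IsLocalTestFunction u) :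
    MemLp (liouvilleZ (pinnedChain ω₂ lam β γ) u) 2 μ := by
  haveI : IsProbabilityMeasure μ := hG.isProbabilityMeasure
  obtain ⟨R, K, -, hle⟩ := CesaroUpgrade.exists_abs_liouvilleZ_le_growth ω₂ lam β γ hu
  obtain ⟨C, hC⟩ :=
    OscillatorChain.exists_integral_abs_pow_add_le_pinnedChain_of_isShiftInvariant
      γ hω hl.le hβ.le hT hG hSI (2 * 3)
  have hmeas : Measurable (liouvilleZ (pinnedChain ω₂ lam β γ) u) := hu.measurable_liouvilleZ _
  have hsq : ∀ σ, |liouvilleZ (pinnedChain ω₂ lam β γ) u σ ^ 2| ≤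
      K ^ 2 * (1 + ‖boxRestrict R σ‖) ^ (2 * 3) := fun σ => by
    rw [abs_of_nonneg (sq_nonneg _), ← sq_abs, pow_mul', ← mul_pow]
    exact pow_le_pow_left₀ (abs_nonneg _) (hle σ) 2
  obtain ⟨hint, -⟩ := CesaroUpgrade.integrable_of_abs_le_growth hsq
    (hmeas.pow_const 2).aestronglyMeasurable hC
  exact (memLp_two_iff_integrable_sq hmeas.aestronglyMeasurable).2 hint

/-- **The coboundary inequality** (arena hypotheses actually used: Gibbs, shift invariance,
measure preservation). For the pinned chain, a shift-invariant DLR state `μ` at `T > 0`, a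
`μ`-preserving dynamics `D`, a local test function `u`, `τ ≥ 0` and `n`:
`∫ (∫_{(0,τ]} J_n∘φ_s)² dμ ≤ (2√Var(A_n u) + τ√Var(A_n r))²`, `r = j₀ − 𝒜u`,
`A_n f = Σ_{i<n} f ∘ τ_i`. [folklore] -/
theorem cob_main {ω₂ lam β : ℝ} (γ : ℝ) (hω : 0 < ω₂) (hl : 0 < lam) (hβ : 0 < β) {T : ℝ}
    (hT : 0 < T) {μ : Measure ChainConfig}
    (hG : (pinnedChain ω₂ lam β γ).IsChainGibbsMeasure T μ) (hSI : IsShiftInvariant μ)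
    (D : InfiniteChainDynamics (pinnedChain ω₂ lam β γ)) (hP : D.PreservesMeasure μ)
    {u : ChainConfig → ℝ} (hu : IsLocalTestFunction u) {τ : ℝ} (hτ : 0 ≤ τ) (n : ℕ) :
    ∫ σ, (∫ s in Ioc (0:ℝ) τ,
        ∑ i ∈ Finset.range n, (pinnedChain ω₂ lam β γ).bondCurrentZ (D.flow s σ) (i : ℤ)) ^ 2 ∂μ
      ≤ (2 * Real.sqrt (variance (fun σ => ∑ i ∈ Finset.range n, u (chainShift (i : ℤ) σ)) μ)
          + τ * Real.sqrt (variance (fun σ => ∑ i ∈ Finset.range n,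
              ((pinnedChain ω₂ lam β γ).bondCurrentZ (chainShift (i : ℤ) σ) 0 -
                liouvilleZ (pinnedChain ω₂ lam β γ) u (chainShift (i : ℤ) σ))) μ)) ^ 2 := by
  set Au : ChainConfig → ℝ := fun σ => ∑ i ∈ Finset.range n, u (chainShift (i : ℤ) σ) with hAudef
  set Ar : ChainConfig → ℝ := fun σ => ∑ i ∈ Finset.range n,
      ((pinnedChain ω₂ lam β γ).bondCurrentZ (chainShift (i : ℤ) σ) 0 -
        liouvilleZ (pinnedChain ω₂ lam β γ) u (chainShift (i : ℤ) σ)) with hArdef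
  -- arena facts
  haveI : IsProbabilityMeasure μ := hG.isProbabilityMeasure
  have hss : (pinnedChain ω₂ lam β γ).HasSuperstabilityEstimate μ :=
    OscillatorChain.hasSuperstabilityEstimate_of_isShiftInvariant_pinnedChain γ hω hl.le hβ.le hT hG hSI
  have hUc2 : ContDiff ℝ 2 (pinnedChain ω₂ lam β γ).U :=
    OscillatorChain.contDiff_two_U_pinnedChain ω₂ lam β γ
  have hVc2 : ContDiff ℝ 2 (pinnedChain ω₂ lam β γ).V :=
    OscillatorChain.contDiff_two_V_pinnedChain ω₂ lam β γ
  have hVc : Continuous (deriv (pinnedChain ω₂ lam β γ).V) := hVc2.continuous_deriv (by norm_num)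
  -- measurability and square integrability of the observables
  have hLm : Measurable (liouvilleZ (pinnedChain ω₂ lam β γ) u) := hu.measurable_liouvilleZ _
  have hL2 : MemLp (liouvilleZ (pinnedChain ω₂ lam β γ) u) 2 μ :=
    cob_memLp_liouvilleZ γ hω hl hβ hT hG hSI hu
  have hj2 : MemLp (fun σ => (pinnedChain ω₂ lam β γ).bondCurrentZ σ 0) 2 μ :=
    OscillatorChain.memLp_bondCurrentZ_pinnedChain γ hω.le hl.le hβ hss 0 ENNReal.ofNat_ne_top
  have hAum : Measurable Au :=
    Finset.measurable_sum _ fun i _ => hu.measurable.comp (chainShift.measurable (i : ℤ))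
  obtain ⟨M, hM⟩ := hu.exists_bound
  have hAubd : ∀ σ, |Au σ| ≤ n * M := fun σ => by
    calc |Au σ| ≤ ∑ i ∈ Finset.range n, |u (chainShift (i : ℤ) σ)| := Finset.abs_sum_le_sum_abs _ _
      _ ≤ ∑ _i ∈ Finset.range n, M := Finset.sum_le_sum fun i _ => hM _
      _ = n * M := by rw [Finset.sum_const, Finset.card_range, nsmul_eq_mul]
  have hAu2 : MemLp Au 2 μ := MemLp.of_bound hAum.aestronglyMeasurable (n * M)
    (Eventually.of_forall fun σ => by rw [Real.norm_eq_abs]; exact hAubd σ)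
  have hArm : Measurable Ar := Finset.measurable_sum _ fun i _ =>
    ((measurable_bondCurrentZ _ 0).comp (chainShift.measurable (i : ℤ))).sub
      (hLm.comp (chainShift.measurable (i : ℤ)))
  have hri : ∀ i ∈ Finset.range n, MemLp (fun σ =>
      (pinnedChain ω₂ lam β γ).bondCurrentZ (chainShift (i : ℤ) σ) 0 -
        liouvilleZ (pinnedChain ω₂ lam β γ) u (chainShift (i : ℤ) σ)) 2 μ := fun i _ =>
    (hj2.comp_measurePreserving (hSI.measurePreserving_chainShift (i : ℤ))).sub
      (hL2.comp_measurePreserving (hSI.measurePreserving_chainShift (i : ℤ)))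
  have hAr2 : MemLp Ar 2 μ := memLp_finsetSum _ hri
  -- `∫ A_n r dμ = 0`, hence `∫ (A_n r)² = Var(A_n r)`
  have hLint : ∫ σ, liouvilleZ (pinnedChain ω₂ lam β γ) u σ ∂μ = 0 :=
    (OscillatorChain.isTimeInvariant_pinnedChain_of_isShiftInvariant γ hω hl.le hβ.le hT hG hSI
      u hu).2
  have hjint : ∫ σ, (pinnedChain ω₂ lam β γ).bondCurrentZ σ 0 ∂μ = 0 :=
    hG.integral_bondCurrentZ_eq_zero 0
  have hArint : ∫ σ, Ar σ ∂μ = 0 := by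
    rw [hArdef, integral_finsetSum _ fun i hi => (hri i hi).integrable one_le_two]
    refine Finset.sum_eq_zero fun i _ => ?_
    have h1 : ∫ σ, ((pinnedChain ω₂ lam β γ).bondCurrentZ (chainShift (i : ℤ) σ) 0 -
        liouvilleZ (pinnedChain ω₂ lam β γ) u (chainShift (i : ℤ) σ)) ∂μ =
        ∫ σ, ((pinnedChain ω₂ lam β γ).bondCurrentZ σ 0 - liouvilleZ (pinnedChain ω₂ lam β γ) u σ) ∂μ :=
      integral_comp_eq_of_measurePreserving (hSI.measurePreserving_chainShift (i : ℤ))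
        (g := fun σ => (pinnedChain ω₂ lam β γ).bondCurrentZ σ 0 - liouvilleZ (pinnedChain ω₂ lam β γ) u σ)
        ((measurable_bondCurrentZ _ 0).sub hLm)
    rw [h1, integral_sub (hj2.integrable one_le_two) (hL2.integrable one_le_two), hjint, hLint,
      sub_zero]
  have hArsq : ∫ σ, Ar σ ^ 2 ∂μ = variance Ar μ :=
    (variance_of_integral_eq_zero hArm.aemeasurable hArint).symm
  -- a measurable full-measure part `S` of the carrier
  obtain ⟨Z, hZsub, hZm, hZ0⟩ := exists_measurable_superset_of_null (ae_iff.1 hP.1)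
  set S : Set ChainConfig := Zᶜ with hSdef
  have hSm : MeasurableSet S := hZm.compl
  have hSsub : S ⊆ D.carrier := fun σ hσ => by_contra fun h => hσ (hZsub h)
  have hSae : ∀ᵐ σ ∂μ, σ ∈ S := by
    rw [ae_iff]
    have : {a | ¬a ∈ S} = Z := by ext a; simp [hSdef]
    rw [this]
    exact hZ0
  -- continuity of `A_n r` along the orbits of the carrier
  have hArc : ∀ σ ∈ D.carrier, Continuous fun t => Ar (D.flow t σ) := fun σ hσ => by
    simp only [hArdef]
    refine continuous_finsetSum _ fun i _ => ?_
    have h1 : Continuous fun t =>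
        (pinnedChain ω₂ lam β γ).bondCurrentZ (chainShift (i : ℤ) (D.flow t σ)) 0 := by
      simp only [OscillatorChain.bondCurrentZ_chainShift, zero_add]
      exact D.continuous_bondCurrentZ_flow hVc hσ i
    exact h1.sub (cob_orbit hUc2 hVc2 hu ((D.isSolution σ hσ).chainShift (i : ℤ))).1
  -- the a.e. identity `(∫ J_n∘φ_s)² = (X + Y)²`
  have hae : (fun σ => (∫ s in Ioc (0:ℝ) τ, ∑ i ∈ Finset.range n,
        (pinnedChain ω₂ lam β γ).bondCurrentZ (D.flow s σ) (i : ℤ)) ^ 2) =ᵐ[μ]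
      fun σ => ((Au (D.flow τ σ) - Au σ) +
        ∫ s in Ioc (0:ℝ) τ, S.indicator (fun σ => Ar (D.flow s σ)) σ) ^ 2 := by
    filter_upwards [hSae] with σ hσ
    rw [cob_pointwise hUc2 hVc2 D hu (hSsub hσ) hτ n]
    simp only [hAudef, hArdef, Set.indicator_of_mem hσ]
  rw [integral_congr_ae hae]
  -- Minkowski and the two bounds
  obtain ⟨hX2, hXle⟩ := cob_sqrt_integral_comp_sub_sq_le (hP.2 τ) hAum hAu2
  obtain ⟨hY2, hYle⟩ := cob_setIntegral_indicator_flow D hP hSm hSsub hSae hArm hAr2 hArc hτ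
  have hYsqrt : Real.sqrt (∫ σ, (∫ s in Ioc (0:ℝ) τ, S.indicator (fun σ => Ar (D.flow s σ)) σ) ^ 2 ∂μ)
      ≤ τ * Real.sqrt (variance Ar μ) := by
    rw [← hArsq]
    refine (Real.sqrt_le_sqrt hYle).trans (le_of_eq ?_)
    rw [Real.sqrt_mul (sq_nonneg τ), Real.sqrt_sq hτ]
  have hsum := (sqrt_integral_add_sq_le hX2 hY2).trans (add_le_add hXle hYsqrt)
  have h0 : 0 ≤ ∫ σ, ((Au (D.flow τ σ) - Au σ) +
      ∫ s in Ioc (0:ℝ) τ, S.indicator (fun σ => Ar (D.flow s σ)) σ) ^ 2 ∂μ :=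
    integral_nonneg fun σ => sq_nonneg _
  rw [← Real.sq_sqrt h0]
  exact pow_le_pow_left₀ (Real.sqrt_nonneg _) hsum 2

/-- **S2 `stub_coboundaryInequality`** (registered stub of line `dual-certificate`, crux
`CageBudgetFekete.HeatVarianceCeiling`; the registered statement with its three `let`s inlined — `P`,
`r`, `A` substituted — definitionally equal to `Sig.stub_coboundaryInequality`). For every bounded `C¹` local `u`:
`∫ (∫_{(0,τ]} J_n∘φ_s ds)² dμ ≤ (2·sd(A_n u) + τ·sd(A_n r))²`, `r = j₀ − 𝒜u`,
`A_n f = Σ_{i<n} f∘τ_i`. Proof: `cob_main` (the momentum-reversal, shift-covariance and correlation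
hypotheses of the arena are idle here). [folklore] [cite: DeRoeckHuveneers2015, §2.3 Thm 1] -/
theorem stub_coboundaryInequality :
    ∀ ω₂ lam β γ : ℝ, 0 < ω₂ → 0 < lam → 0 < β → ∀ T : ℝ, 0 < T → ∀ μ : MeasureTheory.Measure Literature.MathematicalPhysics.KineticTheory.HeatConduction.ChainConfig, (Literature.MathematicalPhysics.KineticTheory.HeatConduction.pinnedChain ω₂ lam β γ).IsChainGibbsMeasure T μ → Literature.MathematicalPhysics.KineticTheory.HeatConduction.IsShiftInvariant μ → μ.map (fun σ : Literature.MathematicalPhysics.KineticTheory.HeatConduction.ChainConfig => fun x : ℤ => ((σ x).1, -(σ x).2)) = μ → ∀ D : Literature.MathematicalPhysics.KineticTheory.HeatConduction.InfiniteChainDynamics (Literature.MathematicalPhysics.KineticTheory.HeatConduction.pinnedChain ω₂ lam β γ), D.PreservesMeasure μ → (∀ t : ℝ, ∀ᵐ σ ∂μ, D.flow t (Literature.MathematicalPhysics.KineticTheory.HeatConduction.shift σ) = Literature.MathematicalPhysics.KineticTheory.HeatConduction.shift (D.flow t σ)) → (∀ t : ℝ, D.HasAbsConvergentCorrelation μ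 t) → Continuous (fun t : ℝ => D.currentCorrelation μ t) →
      ∀ u : Literature.MathematicalPhysics.KineticTheory.HeatConduction.ChainConfig → ℝ,
        Literature.MathematicalPhysics.KineticTheory.HeatConduction.IsLocalTestFunction u →
        ∀ τ : ℝ, 0 ≤ τ → ∀ n : ℕ,
          ∫ σ, (∫ s in Set.Ioc (0:ℝ) τ,
              ∑ i ∈ Finset.range n, (Literature.MathematicalPhysics.KineticTheory.HeatConduction.pinnedChain ω₂ lam β γ).bondCurrentZ (D.flow s σ) (i : ℤ)) ^ 2 ∂μ
            ≤ (2 * Real.sqrt (ProbabilityTheory.variance (fun σ : Literature.MathematicalPhysics.KineticTheory.HeatConduction.ChainConfig => ∑ i ∈ Finset.range n, u (fun k : ℤ => σ (k + (i : ℤ)))) μ)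
                + τ * Real.sqrt (ProbabilityTheory.variance (fun σ : Literature.MathematicalPhysics.KineticTheory.HeatConduction.ChainConfig => ∑ i ∈ Finset.range n, ((Literature.MathematicalPhysics.KineticTheory.HeatConduction.pinnedChain ω₂ lam β γ).bondCurrentZ (fun k : ℤ => σ (k + (i : ℤ))) 0 - Literature.MathematicalPhysics.KineticTheory.HeatConduction.liouvilleZ (Literature.MathematicalPhysics.KineticTheory.HeatConduction.pinnedChain ω₂ lam β γ) u (fun k : ℤ => σ (k + (i : ℤ))))) μ)) ^ 2 := by
  intro ω₂ lam β γ hω hl hβ T hT μ hG hSI _ D hP _ _ _ u hu τ hτ n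
  exact cob_main γ hω hl hβ hT hG hSI D hP hu hτ n

end Summit.AtomisticToContinuum.FouriersLaw.Theorems.HeatVarianceCeiling.DualCertificate

end
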